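import Literature.NumberTheory.DiophantineGeometry.LevelThreeHilbertModularSurfaceModel
import Literature.GroupTheory.SpecificGroups.AlternatingSixPSL2Nine
import HarnessLib

/-!
# `A₆ ≅ PSL₂(𝔽₉)` for the level-`3` Hilbert modular surface model: discharge

Discharges the named fact `LevelThreeHMS.alternatingGroup_six_equiv_PSL_two_nine` of
`LevelThreeHilbertModularSurfaceModel.lean` (`A₆ ≅ PSL₂(𝔽₉)`, Gorenstein, *Finite Simple Groups*,
(2.7), the identification under which `PSL₂(𝓞/3)` acts on Ellenberg's model `S` by even
permutations of the coordinates) from the group-theoretic theorem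
`Literature.GroupTheory.SpecificGroups.AltSixPSL.nonempty_alternatingGroup_mulEquiv_PSL`
(Wilson's proof, *The Finite Simple Groups*, §3.3.5), applied to Mathlib's `GaloisField 3 2`
(`|GaloisField 3 2| = 3² = 9`, Mathlib `GaloisField.card`).

## References

* D. Gorenstein, *Finite Simple Groups*, Plenum 1982, §2.1 (2.7). [Gorenstein1982]
* R. A. Wilson, *The Finite Simple Groups*, GTM 251, Springer 2009, §3.3.5. [Wilson2009]
-/

namespace Literature.NumberTheory.DiophantineGeometry

namespace LevelThreeHMS

/-- **`A₆ ≅ PSL₂(𝔽₉)`** (Gorenstein (2.7): `A₁(9) ≅ A₆`), discharging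
`alternatingGroup_six_equiv_PSL_two_nine`: Wilson's proof (§3.3.5) formalised in
`Literature.GroupTheory.SpecificGroups.AltSixPSL`, applied to `GaloisField 3 2`.
[cite: Gorenstein1982, §2.1 (2.7)] -/
theorem alternatingGroup_six_equiv_PSL_two_nine_holds : alternatingGroup_six_equiv_PSL_two_nine :=
  Literature.GroupTheory.SpecificGroups.AltSixPSL.nonempty_alternatingGroup_mulEquiv_PSL
    (GaloisField 3 2) (by rw [GaloisField.card 3 2 two_ne_zero]; norm_num)

end LevelThreeHMS

end Literature.NumberTheory.DiophantineGeometry
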